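import Literature.RingTheory.MvPowerSeries.FrobeniusPowerBasis
import Literature.RingTheory.MvPowerSeries.MonoidPowerSeriesLift
import HarnessLib

/-!
# Parity bookkeeping in `R⟦X_σ⟧`, characteristic `p`: the non-`p`-divisible support of `f` is untouched by every
# cleaning `f ↦ f − gᵖ`, and if it lies in `(X_t : t ∈ T)ⁿ` then `f = ψᵖ + ι` with `ι ∈ (X_t : t ∈ T)ⁿ`

W4.1 support file (crux `Steer`, stmt-ResolutionOfSingularities-16345; line `switching_dichotomy`), res-D-pv-007 AS
res-L0-w41-stub-5, for res-L0-w41-idea-3's G-PERF-DIRECT / NT-DIRECT programme (plan-1 RULING 133): «in `K⟦v⟧`, `char K = 2`,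
`K` perfect, squares have only EVEN monomials (P1) and even-supported series are squares (P2); hence every condition
`f ≡ □ (mod J)` is a condition on the ODD monomials of `f`, which no cleaning `f ↦ f − g²` touches (P3)». This is the
power-series twin of the polynomial kit `…Theorems.SwitchingDichotomy.DescentSpace.{even_of_mem_support_sq,
exists_sq_eq_of_forall_even}` (p525775), written for a general prime power `p = p¹` over the tree's vocabulary
`Literature.RingTheory.MvPowerSeries.{IsSupportedOnMultiples, modComponent, liftExp}` (the `p`-basis decomposition
`f = Σ_{e : σ → Fin p} X^{ν(e)} · f_e`, `f_e ∈ R⟦Xᵖ⟧`, of `FrobeniusPowerBasis.lean`; (P1) = `isSupportedOnMultiples_pow`,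
(P2) = `exists_pow_eq_of_isSupportedOnMultiples` there). Proved here (all `theorem`s, no definitions, no Theses import):
* ideal of a set of variables: `X_mem_span_X`, `monomial_one_mem_pow_span_X` (`X^e ∈ (X_T)^{|e|}` for `e` supported in
  `T`), `exists_le_support_subset_degree_eq`, **`mem_pow_span_X_of_le_sum`** (a series every monomial `m` of which has
  `T`-degree `Σ_{t ∈ T} m t ≥ n` lies in `(X_t : t ∈ T)ⁿ`, finitely many variables) and the converse
  `le_sum_of_mem_pow_span_X` / **`mem_pow_span_X_iff`**;
* `modComponent` calculus: `modComponent_neg`, `modComponent_sub`, `modComponent_mul_of_isSupportedOnMultiples`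
  (`R⟦X^q⟧`-linearity), `isSupportedOnMultiples_pow_prime`, `modComponent_pow_prime` (`(gᵖ)_e = 0` for `e ≠ 0`),
  **`modComponent_sub_pow_prime`** / `modComponent_add_pow_prime` / `modComponent_pow_prime_mul` (P3: the components
  `e ≠ 0` of `f − gᵖ`, `f + gᵖ`, `uᵖ·f` are those of `f`, resp. `uᵖ`· those of `f`), `coeff_sub_pow_prime_of_not_dvd`
  (coefficientwise form), `ne_zero_of_coeff_modComponent_ne_zero` (support of `f_e` ↔ support of `f`);
* decomposition: `eq_modComponent_zero_add_sum` (`f = f₀ + Σ_{e ≠ 0} X^{ν(e)} f_e`), `exists_pow_prime_eq_modComponent_zero`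
  (perfect `R`: `f₀ = ψᵖ`), `sum_modComponent_mem_pow_span_X`;
* **`exists_sub_pow_prime_mem_pow_span_X`** (perfect `R`): if every monomial `m` of `f` with some exponent NOT divisible
  by `p` has `T`-degree `≥ n`, then `f − ψᵖ ∈ (X_t : t ∈ T)ⁿ` for some `ψ` — with `n = 2`, `#T < dim` this is the input
  shape of `SigmaTopLegality.not_hasIsolatedSingularity_of_sub_pow_mem_sq_span` (p529051, (CD0)) after the consumer's
  identification `Ŝ ≃ K⟦v⟧`; `p = 2` reading **`exists_sub_sq_mem_pow_span_X`** (hypothesis on the monomials with an ODD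
  exponent).

Elementary coefficient bookkeeping [folklore; cite: Matsumura1987, §30 proof of Thm. 30.9 p. 243–244 for the `p`-basis of
`R⟦X⟧` over `R⟦Xᵖ⟧`]. OURS (campaign res-hironaka); nothing here is attributed to [Hironaka2017]. -/

noncomputable section

-- `Summit.<S>.<S>.…` duplicates the summit name by design (single-problem summit).
set_option linter.dupNamespace false

open MvPowerSeries
open Literature.RingTheory.MvPowerSeries

namespace Summit.ResolutionOfSingularities.ResolutionOfSingularities.Theorems.SwitchingDichotomy.PowerSeriesParity

universe u v

variable {σ : Type u} {R : Type v} [CommRing R]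

section SpanPow

variable (T : Finset σ)

/-- `X_t ∈ (X_s : s ∈ T)` for `t ∈ T`. [folklore] -/
theorem X_mem_span_X {t : σ} (ht : t ∈ T) :
    (X t : MvPowerSeries σ R) ∈ Ideal.span ((fun s : σ => (X s : MvPowerSeries σ R)) '' (T : Set σ)) :=
  Ideal.subset_span ⟨t, Finset.mem_coe.mpr ht, rfl⟩

/-- `X^e ∈ (X_t : t ∈ T)^{|e|}` when the exponent `e` is supported in `T`. [folklore] -/
theorem monomial_one_mem_pow_span_X {e : σ →₀ ℕ} (he : e.support ⊆ T) :
    (monomial e (1 : R) : MvPowerSeries σ R) ∈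
      Ideal.span ((fun s : σ => (X s : MvPowerSeries σ R)) '' (T : Set σ)) ^ e.degree := by
  classical
  induction e using Finsupp.induction with
  | zero =>
    rw [monomial_zero_one, map_zero, pow_zero, Ideal.one_eq_top]
    exact Submodule.mem_top
  | single_add i n e hi hn ih =>
    have hei : e i = 0 := Finsupp.notMem_support_iff.mp hi
    have hiT : i ∈ T := he (Finsupp.mem_support_iff.mpr (by
      rw [Finsupp.add_apply, Finsupp.single_eq_same, hei, add_zero]; exact hn))
    have heT : e.support ⊆ T := fun j hj => he (Finsupp.mem_support_iff.mpr (by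
      rw [Finsupp.add_apply]
      exact fun h0 => Finsupp.mem_support_iff.mp hj (Nat.eq_zero_of_add_eq_zero_left h0)))
    have hmul : (monomial (Finsupp.single i n + e) (1 : R) : MvPowerSeries σ R) = X i ^ n * monomial e 1 := by
      rw [X_pow_eq, monomial_mul_monomial, one_mul]
    rw [hmul, map_add, Finsupp.degree_single, pow_add]
    exact Ideal.mul_mem_mul (Ideal.pow_mem_pow (X_mem_span_X T hiT) n) (ih heT)

/-- If the `T`-degree `Σ_{t ∈ T} d t` of an exponent `d` is at least `n`, then `d` is divisible by an exponent `e ≤ d`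
supported in `T` of degree exactly `n`. [folklore] -/
theorem exists_le_support_subset_degree_eq (n : ℕ) (d : σ →₀ ℕ) (h : n ≤ ∑ t ∈ T, d t) :
    ∃ e : σ →₀ ℕ, e ≤ d ∧ e.support ⊆ T ∧ e.degree = n := by
  classical
  set dT : σ →₀ ℕ := Finsupp.filter (· ∈ T) d with hdT_def
  have hdT_le : dT ≤ d := fun i => by
    rw [hdT_def, Finsupp.filter_apply]
    split_ifs <;> simp
  have hdT_supp : dT.support ⊆ T := fun i hi => by
    rw [hdT_def, Finsupp.support_filter] at hi
    exact (Finset.mem_filter.mp hi).2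
  have hdT_deg : dT.degree = ∑ t ∈ T, d t := by
    change ∑ i ∈ dT.support, dT i = ∑ t ∈ T, d t
    rw [Finset.sum_subset hdT_supp (fun i _ hi => Finsupp.notMem_support_iff.mp hi)]
    refine Finset.sum_congr rfl fun i hi => ?_
    rw [hdT_def, Finsupp.filter_apply, if_pos hi]
  obtain ⟨e, he_le, he_deg⟩ := Jets.exists_le_degree_eq n dT (hdT_deg ▸ h)
  refine ⟨e, he_le.trans hdT_le, fun i hi => hdT_supp ?_, he_deg⟩
  exact Finsupp.mem_support_iff.mpr fun h0 =>
    Finsupp.mem_support_iff.mp hi (Nat.eq_zero_of_le_zero (h0 ▸ he_le i))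

/-- **A series all of whose monomials have `T`-degree `≥ n` lies in `(X_t : t ∈ T)ⁿ`** (finitely many variables):
write `φ = Σ_{|e| = n, supp e ⊆ T} X^e · φ_e` by distributing each monomial `m` of `φ` to one divisor `X^e`.
[folklore] -/
theorem mem_pow_span_X_of_le_sum [Finite σ] (n : ℕ) (φ : MvPowerSeries σ R)
    (h : ∀ m : σ →₀ ℕ, coeff m φ ≠ 0 → n ≤ ∑ t ∈ T, m t) :
    φ ∈ Ideal.span ((fun s : σ => (X s : MvPowerSeries σ R)) '' (T : Set σ)) ^ n := by
  classical
  -- choose, for every exponent of `T`-degree ≥ n, a divisor supported in `T` of degree `n`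
  have hch : ∀ d : σ →₀ ℕ, ∃ e : σ →₀ ℕ, (n ≤ ∑ t ∈ T, d t) → e ≤ d ∧ e.support ⊆ T ∧ e.degree = n := by
    intro d
    by_cases hd : n ≤ ∑ t ∈ T, d t
    · obtain ⟨e, he⟩ := exists_le_support_subset_degree_eq T n d hd
      exact ⟨e, fun _ => he⟩
    · exact ⟨0, fun h' => (hd h').elim⟩
  choose pref hpref using hch
  let S : Finset (σ →₀ ℕ) :=
    (monoidPowerSeries.finite_degree_le (ι := σ) n).toFinset.filter fun e => e.support ⊆ T ∧ e.degree = n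
  have hS : ∀ e, e ∈ S ↔ e.support ⊆ T ∧ e.degree = n := by
    intro e
    simp only [S, Finset.mem_filter, Set.Finite.mem_toFinset, Set.mem_setOf_eq]
    exact ⟨fun h' => h'.2, fun h' => ⟨h'.2.le, h'⟩⟩
  let G : (σ →₀ ℕ) → MvPowerSeries σ R := fun e d' => if pref (e + d') = e then coeff (e + d') φ else 0
  have hG : ∀ e d' : σ →₀ ℕ, coeff d' (G e) = if pref (e + d') = e then coeff (e + d') φ else 0 := fun _ _ => rfl
  have hφ : φ = ∑ e ∈ S, monomial e (1 : R) * G e := by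
    ext d
    rw [map_sum]
    simp only [coeff_monomial_mul, one_mul]
    by_cases hd : n ≤ ∑ t ∈ T, d t
    · obtain ⟨hle, hsupp, hdeg⟩ := hpref d hd
      rw [Finset.sum_eq_single (pref d)]
      · rw [if_pos hle, hG, add_tsub_cancel_of_le hle, if_pos rfl]
      · intro e _ hne
        split_ifs with hed
        · rw [hG, add_tsub_cancel_of_le hed, if_neg (Ne.symm hne)]
        · rfl
      · intro hnot
        exact (hnot ((hS _).2 ⟨hsupp, hdeg⟩)).elim
    · have h0 : coeff d φ = 0 := by
        by_contra hne
        exact hd (h d hne)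
      rw [h0, eq_comm]
      refine Finset.sum_eq_zero fun e he => ?_
      split_ifs with hed
      · rw [hG, add_tsub_cancel_of_le hed, ite_eq_right_iff]
        exact fun _ => h0
      · rfl
  rw [hφ]
  refine Ideal.sum_mem _ fun e he => Ideal.mul_mem_right _ _ ?_
  rw [← ((hS e).1 he).2]
  exact monomial_one_mem_pow_span_X T ((hS e).1 he).1

/-- Conversely, **every monomial of a member of `(X_t : t ∈ T)ⁿ` has `T`-degree `≥ n`** (any number of variables).
[folklore] -/
theorem le_sum_of_mem_pow_span_X (n : ℕ) {φ : MvPowerSeries σ R}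
    (hφ : φ ∈ Ideal.span ((fun s : σ => (X s : MvPowerSeries σ R)) '' (T : Set σ)) ^ n)
    (m : σ →₀ ℕ) (hm : coeff m φ ≠ 0) : n ≤ ∑ t ∈ T, m t := by
  classical
  induction n generalizing φ m with
  | zero => exact Nat.zero_le _
  | succ n ih =>
    rw [pow_succ] at hφ
    -- members of `Iⁿ·I`: submodule induction over products
    refine Submodule.mul_induction_on (C := fun ψ => ∀ m, coeff m ψ ≠ 0 → n + 1 ≤ ∑ t ∈ T, m t) hφ ?_ ?_ m hm
    · intro a ha b hb m hm
      -- `b ∈ span (X '' T)`: write the coefficient of `a * b`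
      revert m hm
      refine Submodule.span_induction (p := fun b _ => ∀ m, coeff m (a * b) ≠ 0 → n + 1 ≤ ∑ t ∈ T, m t)
        ?_ ?_ ?_ ?_ hb
      · rintro _ ⟨t, ht, rfl⟩ m hm
        have ht' : t ∈ T := Finset.mem_coe.mp ht
        -- `coeff m (a * X t) ≠ 0 ⇒ X_t ∣ X^m` and `coeff (m - single t 1) a ≠ 0`
        have hX : (X t : MvPowerSeries σ R) = monomial (Finsupp.single t 1) 1 := by rw [← X_pow_eq, pow_one]
        change coeff m (a * X t) ≠ 0 at hm
        rw [hX, coeff_mul_monomial, mul_one] at hm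
        split_ifs at hm with hle
        · have h1 : 1 ≤ m t := by simpa using hle t
          have hih := ih ha (m - Finsupp.single t 1) hm
          rw [← Finset.add_sum_erase T _ ht'] at hih ⊢
          rw [Finsupp.tsub_apply, Finsupp.single_eq_same] at hih
          have hrest : ∑ x ∈ T.erase t, (m - Finsupp.single t 1 : σ →₀ ℕ) x = ∑ x ∈ T.erase t, m x :=
            Finset.sum_congr rfl fun x hx => by
              rw [Finsupp.tsub_apply, Finsupp.single_eq_of_ne (Finset.ne_of_mem_erase hx), tsub_zero]
          rw [hrest] at hih
          omega
        · exact absurd rfl hm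
      · intro m hm; exact absurd (by rw [mul_zero, map_zero]) hm
      · intro x y _ _ hx hy m hm
        rw [mul_add, map_add] at hm
        by_cases hx0 : coeff m (a * x) = 0
        · exact hy m (by rwa [hx0, zero_add] at hm)
        · exact hx m hx0
      · intro r x _ hx m hm
        rw [smul_eq_mul, mul_left_comm, coeff_mul] at hm
        obtain ⟨q, hq, hq0⟩ := Finset.exists_ne_zero_of_sum_ne_zero hm
        have hq2 : coeff q.2 (a * x) ≠ 0 := fun h0 => hq0 (by rw [h0, mul_zero])
        have := hx q.2 hq2
        have hqm : q.1 + q.2 = m := Finset.HasAntidiagonal.mem_antidiagonal.mp hq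
        calc n + 1 ≤ ∑ t ∈ T, q.2 t := this
          _ ≤ ∑ t ∈ T, m t := Finset.sum_le_sum fun t _ => by rw [← hqm, Finsupp.add_apply]; exact Nat.le_add_left _ _
    · intro x y hx hy m hm
      rw [map_add] at hm
      by_cases hx0 : coeff m x = 0
      · exact hy m (by rwa [hx0, zero_add] at hm)
      · exact hx m hx0

/-- **`φ ∈ (X_t : t ∈ T)ⁿ ⟺ every monomial of `φ` has `T`-degree `≥ n`** (finitely many variables). [folklore] -/
theorem mem_pow_span_X_iff [Finite σ] (n : ℕ) (φ : MvPowerSeries σ R) :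
    φ ∈ Ideal.span ((fun s : σ => (X s : MvPowerSeries σ R)) '' (T : Set σ)) ^ n ↔
      ∀ m : σ →₀ ℕ, coeff m φ ≠ 0 → n ≤ ∑ t ∈ T, m t :=
  ⟨fun h => le_sum_of_mem_pow_span_X T n h, mem_pow_span_X_of_le_sum T n φ⟩

end SpanPow

section ModComponent

variable [Fintype σ] (q : ℕ)

/-- `modComponent` commutes with negation. [cite: Matsumura1987, §30 proof of Thm. 30.9 p. 243] -/
theorem modComponent_neg (φ : MvPowerSeries σ R) (e : σ → Fin q) :
    modComponent q (-φ) e = -modComponent q φ e := by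
  ext M
  simp only [map_neg, coeff_modComponent]
  split_ifs <;> simp

/-- `modComponent` commutes with subtraction. [cite: Matsumura1987, §30 proof of Thm. 30.9 p. 243] -/
theorem modComponent_sub (φ ψ : MvPowerSeries σ R) (e : σ → Fin q) :
    modComponent q (φ - ψ) e = modComponent q φ e - modComponent q ψ e := by
  rw [sub_eq_add_neg, modComponent_add, modComponent_neg, ← sub_eq_add_neg]

variable [NeZero q] [DecidableEq σ]

/-- **`R⟦X^q⟧`-linearity of the components**: `(ψ·φ)_e = ψ·φ_e` for `ψ` supported on `qℕ^σ`.
[cite: Matsumura1987, §30 proof of Thm. 30.9 p. 243] -/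
theorem modComponent_mul_of_isSupportedOnMultiples {ψ : MvPowerSeries σ R} (hψ : IsSupportedOnMultiples q ψ)
    (φ : MvPowerSeries σ R) (e : σ → Fin q) :
    modComponent q (ψ * φ) e = ψ * modComponent q φ e := by
  have hdec : ψ * φ = ∑ e' : σ → Fin q, monomial (liftExp q e') (1 : R) * (ψ * modComponent q φ e') := by
    conv_lhs => rw [eq_sum_monomial_mul_modComponent q φ]
    rw [Finset.mul_sum]
    exact Finset.sum_congr rfl fun e' _ => by ring
  exact modComponent_eq_of_eq_sum q _ (fun e' => hψ.mul (isSupportedOnMultiples_modComponent q φ e')) hdec e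

omit [NeZero q] [DecidableEq σ] in
/-- A nonzero coefficient of the component `φ_e` at `M` comes from the nonzero coefficient of `φ` at `M + ν(e)`, with
`M ∈ qℕ^σ`. [cite: Matsumura1987, §30 proof of Thm. 30.9 p. 243] -/
theorem ne_zero_of_coeff_modComponent_ne_zero (φ : MvPowerSeries σ R) (e : σ → Fin q) {M : σ →₀ ℕ}
    (hM : coeff M (modComponent q φ e) ≠ 0) : (∀ i, q ∣ M i) ∧ coeff (M + liftExp q e) φ ≠ 0 := by
  rw [coeff_modComponent] at hM
  by_cases h : ∀ i, q ∣ M i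
  · exact ⟨h, by rwa [if_pos h] at hM⟩
  · exact absurd (if_neg h) hM

omit [DecidableEq σ] in
/-- For `e ≠ 0` and `M ∈ qℕ^σ`, the exponent `M + ν(e)` has a coordinate NOT divisible by `q`.
[cite: Matsumura1987, §30 proof of Thm. 30.9 p. 243] -/
theorem exists_not_dvd_add_liftExp {e : σ → Fin q} (he : e ≠ 0) {M : σ →₀ ℕ} (hM : ∀ i, q ∣ M i) :
    ∃ i, ¬ q ∣ (M + liftExp q e) i := by
  obtain ⟨i, hi⟩ : ∃ i, e i ≠ 0 := not_forall.mp fun hne => he (funext hne)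
  refine ⟨i, fun hdvd => hi (Fin.ext ?_)⟩
  rw [Finsupp.add_apply, liftExp_apply] at hdvd
  have h1 : q ∣ (e i : ℕ) := (Nat.dvd_add_right (hM i)).mp hdvd
  have h2 : (e i : ℕ) < q := (e i).2
  rw [Fin.val_zero]
  exact Nat.eq_zero_of_dvd_of_lt h1 h2

/-- **`f = f₀ + Σ_{e ≠ 0} X^{ν(e)} f_e`**: the `q`-adic decomposition split into its lattice part and the rest.
[cite: Matsumura1987, §30 proof of Thm. 30.9 p. 243] -/
theorem eq_modComponent_zero_add_sum (φ : MvPowerSeries σ R) :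
    φ = modComponent q φ 0 +
      ∑ e ∈ (Finset.univ : Finset (σ → Fin q)).erase 0, monomial (liftExp q e) (1 : R) * modComponent q φ e := by
  conv_lhs => rw [eq_sum_monomial_mul_modComponent q φ, ← Finset.add_sum_erase _ _ (Finset.mem_univ (0 : σ → Fin q))]
  rw [show liftExp q (0 : σ → Fin q) = 0 from by ext i; rfl, monomial_zero_one, one_mul]

/-- The sum `Σ_{e ≠ 0} X^{ν(e)} f_e` lies in `(X_t : t ∈ T)ⁿ` as soon as every monomial `m` of `f` with a coordinate not
divisible by `q` has `T`-degree `≥ n`. [folklore] -/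
theorem sum_modComponent_mem_pow_span_X (T : Finset σ) (n : ℕ) (φ : MvPowerSeries σ R)
    (h : ∀ m : σ →₀ ℕ, (∃ i, ¬ q ∣ m i) → coeff m φ ≠ 0 → n ≤ ∑ t ∈ T, m t) :
    (∑ e ∈ (Finset.univ : Finset (σ → Fin q)).erase 0, monomial (liftExp q e) (1 : R) * modComponent q φ e) ∈
      Ideal.span ((fun s : σ => (X s : MvPowerSeries σ R)) '' (T : Set σ)) ^ n := by
  refine Ideal.sum_mem _ fun e he => ?_
  have he0 : e ≠ 0 := Finset.ne_of_mem_erase he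
  refine mem_pow_span_X_of_le_sum T n _ fun m hm => ?_
  rw [coeff_monomial_mul, one_mul] at hm
  split_ifs at hm with hle
  · obtain ⟨hM, hφ⟩ := ne_zero_of_coeff_modComponent_ne_zero q φ e hm
    have hm' : m - liftExp q e + liftExp q e = m := tsub_add_cancel_of_le hle
    exact h _ (hm' ▸ exists_not_dvd_add_liftExp q he0 hM) (hm' ▸ hφ)
  · exact absurd rfl hm

end ModComponent

section Frobenius

variable [Fintype σ] [DecidableEq σ] (p : ℕ) [hp : Fact p.Prime] [CharP R p]

omit [Fintype σ] [DecidableEq σ] in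
/-- (P1) **A `p`-th power is supported on `pℕ^σ`** (`(Σ a_m X^m)ᵖ = Σ a_mᵖ X^{pm}`): its coefficients at exponents
with a coordinate not divisible by `p` vanish. [cite: Matsumura1987, §30 proof of Thm. 30.9 p. 244] -/
theorem isSupportedOnMultiples_pow_prime (g : MvPowerSeries σ R) : IsSupportedOnMultiples p (g ^ p) := by
  simpa using isSupportedOnMultiples_pow p g 1

omit [Fintype σ] [DecidableEq σ] in
/-- (P1) `coeff_m (gᵖ) = 0` if some `m i` is not divisible by `p`. [cite: Matsumura1987, §30 proof of Thm. 30.9 p. 244] -/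
theorem coeff_pow_prime_eq_zero (g : MvPowerSeries σ R) {m : σ →₀ ℕ} (hm : ∃ i, ¬ p ∣ m i) :
    coeff m (g ^ p) = 0 :=
  isSupportedOnMultiples_pow_prime p g m hm

omit [Fintype σ] [DecidableEq σ] in
/-- (P3) **Cleaning never touches the non-`p`-divisible support**: `coeff_m (f − gᵖ) = coeff_m f` if `¬ p ∣ m i`. [folklore] -/
theorem coeff_sub_pow_prime_of_not_dvd (f g : MvPowerSeries σ R) {m : σ →₀ ℕ} (hm : ∃ i, ¬ p ∣ m i) :
    coeff m (f - g ^ p) = coeff m f := by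
  rw [map_sub, coeff_pow_prime_eq_zero p g hm, sub_zero]

/-- Components of a `p`-th power: `(gᵖ)_0 = gᵖ`, `(gᵖ)_e = 0` for `e ≠ 0`. [cite: Matsumura1987, §30 proof of Thm. 30.9 p. 244] -/
theorem modComponent_pow_prime (g : MvPowerSeries σ R) (e : σ → Fin p) :
    modComponent p (g ^ p) e = if e = 0 then g ^ p else 0 :=
  haveI : NeZero p := ⟨hp.out.ne_zero⟩
  modComponent_of_isSupportedOnMultiples p (isSupportedOnMultiples_pow_prime p g) e

/-- (P3) **The components `e ≠ 0` of `f − gᵖ` are those of `f`.** [folklore] -/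
theorem modComponent_sub_pow_prime (f g : MvPowerSeries σ R) {e : σ → Fin p} (he : e ≠ 0) :
    modComponent p (f - g ^ p) e = modComponent p f e := by
  rw [modComponent_sub, modComponent_pow_prime, if_neg he, sub_zero]

/-- (P3) The components `e ≠ 0` of `f + gᵖ` are those of `f`. [folklore] -/
theorem modComponent_add_pow_prime (f g : MvPowerSeries σ R) {e : σ → Fin p} (he : e ≠ 0) :
    modComponent p (f + g ^ p) e = modComponent p f e := by
  rw [modComponent_add, modComponent_pow_prime, if_neg he, add_zero]

/-- (P3) The components of `uᵖ·f` are `uᵖ` times those of `f` (absorbing `p`-th-power units). [folklore] -/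
theorem modComponent_pow_prime_mul (u f : MvPowerSeries σ R) (e : σ → Fin p) :
    modComponent p (u ^ p * f) e = u ^ p * modComponent p f e :=
  haveI : NeZero p := ⟨hp.out.ne_zero⟩
  modComponent_mul_of_isSupportedOnMultiples p (isSupportedOnMultiples_pow_prime p u) f e

omit [DecidableEq σ] in
/-- (P2) **Over a perfect coefficient ring the lattice component is a `p`-th power**: `f₀ = ψᵖ`.
[cite: Matsumura1987, §30 proof of Thm. 30.9 p. 244] -/
theorem exists_pow_prime_eq_modComponent_zero [PerfectRing R p] (f : MvPowerSeries σ R) :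
    ∃ ψ : MvPowerSeries σ R, ψ ^ p = modComponent p f 0 := by
  simpa using exists_pow_eq_of_isSupportedOnMultiples p (ℓ := 1)
    (by simpa using isSupportedOnMultiples_modComponent p f 0)

/-- **Main lemma (perfect coefficient ring of characteristic `p`, finitely many variables).** If every monomial `m` of
`f` having some exponent not divisible by `p` has `T`-degree `Σ_{t ∈ T} m t ≥ n`, then `f − ψᵖ ∈ (X_t : t ∈ T)ⁿ` for
some `ψ` (namely `ψᵖ = f₀`, the lattice part). With `n = 2` and `#T < dim` this is the hypothesis of (CD0)
`SigmaTopLegality.not_hasIsolatedSingularity_of_sub_pow_mem_sq_span`. [folklore] -/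
theorem exists_sub_pow_prime_mem_pow_span_X [PerfectRing R p] (T : Finset σ) (n : ℕ) (f : MvPowerSeries σ R)
    (h : ∀ m : σ →₀ ℕ, (∃ i, ¬ p ∣ m i) → coeff m f ≠ 0 → n ≤ ∑ t ∈ T, m t) :
    ∃ ψ : MvPowerSeries σ R,
      f - ψ ^ p ∈ Ideal.span ((fun s : σ => (X s : MvPowerSeries σ R)) '' (T : Set σ)) ^ n := by
  haveI : NeZero p := ⟨hp.out.ne_zero⟩
  obtain ⟨ψ, hψ⟩ := exists_pow_prime_eq_modComponent_zero p f
  refine ⟨ψ, ?_⟩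
  have hf : f - ψ ^ p =
      ∑ e ∈ (Finset.univ : Finset (σ → Fin p)).erase 0, monomial (liftExp p e) (1 : R) * modComponent p f e := by
    rw [hψ, sub_eq_iff_eq_add']
    exact eq_modComponent_zero_add_sum p f
  rw [hf]
  exact sum_modComponent_mem_pow_span_X p T n f h

end Frobenius

section CharTwo

variable [Fintype σ] [DecidableEq σ] [CharP R 2]

omit [Fintype σ] [DecidableEq σ] in
/-- `p = 2` reading of (P1): **squares have only even monomials** — `coeff_m (g²) = 0` if some `m i` is odd. [folklore] -/
theorem coeff_sq_eq_zero_of_odd (g : MvPowerSeries σ R) {m : σ →₀ ℕ} (hm : ∃ i, Odd (m i)) : coeff m (g ^ 2) = 0 :=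
  haveI : Fact (Nat.Prime 2) := ⟨Nat.prime_two⟩
  coeff_pow_prime_eq_zero 2 g (hm.imp fun _ hi => Nat.two_dvd_ne_zero.mpr (Nat.odd_iff.mp hi))

omit [Fintype σ] [DecidableEq σ] in
/-- `p = 2` reading of (P3): **the odd coefficients of `f − g²` are those of `f`.** [folklore] -/
theorem coeff_sub_sq_of_odd (f g : MvPowerSeries σ R) {m : σ →₀ ℕ} (hm : ∃ i, Odd (m i)) :
    coeff m (f - g ^ 2) = coeff m f := by
  rw [map_sub, coeff_sq_eq_zero_of_odd g hm, sub_zero]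

/-- `p = 2` reading of the main lemma: **if every ODD monomial of `f` (some exponent odd) has `T`-degree `≥ n`, then
`f = ψ² + ι` with `ι ∈ (X_t : t ∈ T)ⁿ`** (`R` perfect of characteristic `2`, e.g. a perfect field). [folklore] -/
theorem exists_sub_sq_mem_pow_span_X [PerfectRing R 2] (T : Finset σ) (n : ℕ) (f : MvPowerSeries σ R)
    (h : ∀ m : σ →₀ ℕ, (∃ i, Odd (m i)) → coeff m f ≠ 0 → n ≤ ∑ t ∈ T, m t) :
    ∃ ψ : MvPowerSeries σ R,
      f - ψ ^ 2 ∈ Ideal.span ((fun s : σ => (X s : MvPowerSeries σ R)) '' (T : Set σ)) ^ n :=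
  haveI : Fact (Nat.Prime 2) := ⟨Nat.prime_two⟩
  exists_sub_pow_prime_mem_pow_span_X 2 T n f fun m hm =>
    h m (hm.imp fun _ hi => Nat.odd_iff.mpr (Nat.two_dvd_ne_zero.mp hi))

end CharTwo

end Summit.ResolutionOfSingularities.ResolutionOfSingularities.Theorems.SwitchingDichotomy.PowerSeriesParity

end
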